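import Literature.LinearAlgebra.Matrix.LatimerMacDuffeeCompanion
import Mathlib.LinearAlgebra.Determinant
import HarnessLib

/-!
# TAUSSKY: under the Latimer–MacDuffee–Taussky correspondence the TRANSPOSED matrix is the DUAL
# («complementary», «inverse») class — `ℤⁿ_{Aᵀ} ≅ Hom_{ℤ[θ]}(ℤⁿ_A, ℤ[θ]) ≅ ((a) : J)`, via the Frobenius form
# of `ℤ[θ] = ℤ[X]/(f)`; and `ℤⁿ_{C_fᵀ} ≅ ℤ[θ]`

Topic `LinearAlgebra/Matrix`, namespace `Literature.LinearAlgebra.Matrix`; fifth file of the series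
`LatimerMacDuffee.lean` / `LatimerMacDuffeeIdeal.lean` / `LatimerMacDuffeeCorrespondence.lean` /
`LatimerMacDuffeeCompanion.lean` (the module `ℤⁿ_A = QuotModule f A hA` of an integer matrix root `A` of the monic
`f`, `θ` acting as `v ↦ A v`; the bijection `Φ` from the `GLₙ(ℤ)`-classes of matrix roots of `f` onto the ideal
classes of `ℤ[θ] = ℤ[X]/(f) = AdjoinRoot f`, `Φ [A] = [J]` whenever `ℤⁿ_A ≅ J`; `Φ [C_f] = [(1)]` for the companion
matrix).  THEOREMS ONLY: no definition, no instance, no notation, no named fact (net Literature debt `0`).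

## Sources, VERBATIM

O. Taussky, *A result concerning classes of matrices*, J. Number Theory 6 (1974) 64–71 [Taussky1974], §1, p. 64
(held `paper:doi-10-1016-0022-314x-74-90009-2`, chunk p0001): "It is known that the matrix classes corresponding
to `f(x)` are in 1-1 correspondence with the ideal classes in the order `Z[α]` […] In this correspondence the
principal class in `Z[α]` corresponds to the class of the companion matrix and the class of the transposed matrix
corresponds to the complementary ideal class."; §4, p. 68: "Three items of this correspondence will now be
discussed: (I) the principal class, (II) the transposed matrix representation, (III) the role of the ideal
matrices. (I): […] If `1, α, …, αⁿ⁻¹` is the basis, then the companion matrix `C` has these `n` elements as an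
eigenvector […] we want to exploit the fact that the transposed matrix class corresponds to the inverse ideal
class."  The original proof: O. Taussky, *On matrix classes corresponding to an ideal and its inverse*, Illinois
J. Math. 1 (1957) 108–113 [Taussky1957] (not held; acquisition request acq-13652) — the proofs below are
independent of it (Frobenius reciprocity instead of ideal matrices).

J. A. Buchmann, H. W. Lenstra Jr., *Approximating rings of integers in number fields*, J. Théor. Nombres Bordeaux 6
(1994) 221–260 [BuchmannLenstra1994], §2 (2.2) `A† = Hom(A, ℤ)`, Prop. 2.7 and Example 2.8, pp. 229–231: for
`A = ℤ[X]/(f)`, "if we write `α = (X mod f)` then `A† = f′(α)⁻¹A` […] This shows that `A†` is invertible, so 2.7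
implies that `A` is a Gorenstein ring" — i.e. `Hom_ℤ(A, ℤ) ≅ A` as `A`-modules.  S. Marseglia, *Computing the
ideal class monoid of an order*, J. Lond. Math. Soc. 101 (2020) [Marseglia2019] (held `paper:arxiv-1805.09671`),
§2, p. 4: "`(I:J) = {x ∈ K : xJ ⊆ I}`"; §3 Cor. 3.3, p. 6: "Let `I` and `J` be two fractional `R`-ideals. Then we
have a natural identification `Hom_R(I,J) = (J:I)`."

CONVENTIONS (as in `LatimerMacDuffeeCompanion`).  The printed correspondence attaches to `A` the ideal spanned by
an eigenvector `A v = θ v` (rows), the tree's `Φ` the module `ℤⁿ_A` with `θ` acting on columns; the printed class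
of `A` is the tree's `Φ [Aᵀ]`, and by §3/§5 below the two differ exactly by TAUSSKY's duality.  The «complementary
ideal» of `J` is `J′ = {x ∈ ℚ(θ) : Tr(xJ) ⊆ ℤ} ≅ Hom_ℤ(J, ℤ)`; for the monogenic order `ℤ[θ]` one has
`ℤ[θ]′ = f′(θ)⁻¹ℤ[θ]` (EULER; BUCHMANN–LENSTRA 2.8; the tree's `traceDual_adjoin_eq` /
`CMOrderGorenstein.eq_spanSingleton_inv_mul_of_monogenic` in the number-field setting), hence
`J′ = f′(θ)⁻¹(ℤ[θ] : J) ≅ Hom_{ℤ[θ]}(J, ℤ[θ])`, and for `0 ≠ a ∈ J` the integral representative `a(ℤ[θ] : J) =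
((a) : J) = {y ∈ ℤ[θ] : yJ ⊆ (a)}` (Mathlib's `Submodule.colon (Ideal.span {a}) J`) lies in the same class. This
file works inside `ℤ[θ] = AdjoinRoot f` throughout (no field of fractions): the FROBENIUS FORM
`λ(s) = ` the coefficient of `θⁿ⁻¹` in `s` (`= Tr(s/f′(θ))` by EULER's lemma, not needed here), written
`(AdjoinRoot.modByMonicHom _ s).coeff (n - 1)`, replaces the trace.

## What is formalised

`f ∈ ℤ[X]` monic of degree `n` (`[Fact f.Monic]`, `hdeg : f.natDegree = n`), `θ = AdjoinRoot.root f`,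
`C_f = companion (fun i : Fin n ↦ f.coeff i)`; `[IsDomain (AdjoinRoot f)]` only in §5–§6 (and for `Φ`).

* §1 FROBENIUS RECIPROCITY **`exists_unique_linearMap_coeff_eq`**: for every `ℤ[θ]`-module `M` and `ℤ`-linear
  `ψ : M → ℤ` there is a unique `ℤ[θ]`-linear `φ : M → ℤ[θ]` with `λ ∘ φ = ψ` (`Hom_ℤ(M, ℤ) = λ ∘ Hom_{ℤ[θ]}(M, ℤ[θ])`;
  proof: the moment map `s ↦ (λ(θⁱs))ᵢ`, `ℤ[θ] ≅ ℤⁿ`, is unitriangular on `θⁿ⁻¹, …, θ, 1`, and intertwines `θ`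
  with `C_fᵀ`); **`exists_unique_forall_coeff_mul_eq`** (the pairing `λ(st)` is perfect: `Hom_ℤ(ℤ[θ], ℤ) =
  ℤ[θ]·λ`), `eq_zero_of_forall_coeff_mul_eq_zero` (non-degeneracy).
* §2 `aeval_transpose_eq_zero_iff` (`f(Aᵀ) = 0 ⟺ f(A) = 0`), `exists_conj_transpose_iff` (`A ∼ B ⟺ Aᵀ ∼ Bᵀ`),
  **`QuotModule.nonempty_linearEquiv_companion_transpose`** (`ℤⁿ_{C_fᵀ} ≅ ℤ[θ]`), `…_top`,
  **`exists_conj_companion_transpose`** (`C_f ∼ C_fᵀ` over `GLₙ(ℤ)`, any monic `f`), `apply_companion_transpose_eq_top`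
  (`Φ [C_fᵀ] = [(1)]`).
* §3 **`QuotModule.nonempty_linearEquiv_transpose_dual`** (TRANSPOSE = DUAL: `ℤⁿ_{Aᵀ} ≅ Hom_{ℤ[θ]}(ℤⁿ_A, ℤ[θ])`),
  `QuotModule.nonempty_linearEquiv_dual_transpose` (`ℤⁿ_A ≅ Hom(ℤⁿ_{Aᵀ}, ℤ[θ])`: the modules are reflexive).
* §4 (any domain `R`) **`nonempty_dual_linearEquiv_colon`** (`Hom_R(J, R) ≅ ((a) : J)` for `0 ≠ a ∈ J` —
  MARSEGLIA's `Hom_R(I, J) = (J : I)`), `colon_span_singleton_eq_of_mul_eq` (`IJ = (a) ⟹ ((a) : J) = I`).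
* §5 **`QuotModule.nonempty_linearEquiv_transpose_colon`** (TAUSSKY 1957/1974: `ℤⁿ_A ≅ J`, `0 ≠ a ∈ J` ⟹
  `ℤⁿ_{Aᵀ} ≅ ((a) : J)` — the complementary class), **`QuotModule.nonempty_linearEquiv_transpose_of_mul_eq`**
  (`IJ = (a)` ⟹ `ℤⁿ_{Aᵀ} ≅ I` — «the transposed matrix class corresponds to the inverse ideal class»),
  `apply_transpose_eq_colon` / `apply_transpose_eq_of_mul_eq` (`Φ [Aᵀ] = [((a) : J)] = [I]`).
* §6 **`exists_conj_transpose_self_iff_idealClass`** (`A ∼ Aᵀ ⟺ (x)J = (y)((a) : J)` for some `x, y ≠ 0`),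
  `exists_conj_transpose_self_of_nonempty_linearEquiv` (principal class ⟹ `A ∼ Aᵀ`),
  `exists_conj_transpose_self_of_isPrincipalIdealRing` (class number one ⟹ every `A ∼ Aᵀ`).
-/

open Polynomial
open scoped Matrix

noncomputable section

namespace Literature.LinearAlgebra.Matrix

variable {n : ℕ}

/-! ### §1 The Frobenius form `λ(s) = ` the coefficient of `θⁿ⁻¹` in `s ∈ ℤ[θ]` -/

section Frobenius

variable {f : ℤ[X]} [Fact f.Monic]

/-- `λ(θᵉ) = [e = n - 1]` for `e < n` (`θᵉ` is its own remainder modulo the monic `f` of degree `n`). [folklore] -/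
private theorem coeff_modByMonicHom_root_pow (hdeg : f.natDegree = n) {e : ℕ} (he : e < n) :
    (AdjoinRoot.modByMonicHom (Fact.out : f.Monic) (AdjoinRoot.root f ^ e)).coeff (n - 1) =
      if n - 1 = e then 1 else 0 := by
  have hf : f.Monic := Fact.out
  have hX : (X ^ e : ℤ[X]) %ₘ f = X ^ e := by
    rw [Polynomial.modByMonic_eq_self_iff hf, degree_X_pow, degree_eq_natDegree hf.ne_zero, hdeg]
    exact_mod_cast he
  rw [← AdjoinRoot.mk_X, ← map_pow, AdjoinRoot.modByMonicHom_mk, hX, coeff_X_pow]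

/-- `θⁿ = Σᵢ (-fᵢ) θⁱ` in `ℤ[θ]`. [folklore] -/
private theorem root_pow_natDegree_eq_sum (hdeg : f.natDegree = n) :
    AdjoinRoot.root f ^ n = ∑ i : Fin n, ((-f.coeff i : ℤ) : AdjoinRoot f) * AdjoinRoot.root f ^ (i : ℕ) := by
  have hf : f.Monic := Fact.out
  have hf' : f = X ^ n + ∑ i : Fin n, C (f.coeff i) * X ^ (i : ℕ) := by
    conv_lhs => rw [hf.as_sum, hdeg]
    rw [Fin.sum_univ_eq_sum_range (fun i ↦ C (f.coeff i) * X ^ i) n]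
  have h0 : aeval (AdjoinRoot.root f) (X ^ n + ∑ i : Fin n, C (f.coeff i) * X ^ (i : ℕ)) = 0 := by
    rw [← hf', AdjoinRoot.aeval_eq, AdjoinRoot.mk_self]
  simp only [map_add, map_pow, aeval_X, map_sum, map_mul, map_intCast, eq_intCast] at h0
  rw [eq_neg_of_add_eq_zero_left h0, ← Finset.sum_neg_distrib]
  refine Finset.sum_congr rfl fun i _ ↦ ?_
  push_cast
  ring

/-- **`C_fᵀ` is the matrix of `θ` on «moment vectors»**: for an additive `ω : M → ℤ` on a `ℤ[θ]`-module `M` and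
`m ∈ M`, `C_fᵀ · (ω(θⁱ m))ᵢ = (ω(θⁱ · θ m))ᵢ` (rows `i < n - 1` shift; the last row is `θⁿ = -Σ fⱼ θʲ`). [folklore] -/
private theorem transpose_companion_mulVec_eq (hdeg : f.natDegree = n) {M : Type*} [AddCommGroup M]
    [Module (AdjoinRoot f) M] (ω : M →+ ℤ) (m : M) :
    (companion fun i : Fin n ↦ f.coeff i)ᵀ *ᵥ (fun i : Fin n ↦ ω (AdjoinRoot.root f ^ (i : ℕ) • m)) =
      fun i : Fin n ↦ ω (AdjoinRoot.root f ^ (i : ℕ) • AdjoinRoot.root f • m) := by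
  funext i
  rw [smul_smul, ← pow_succ]
  change ∑ j : Fin n, (companion fun i : Fin n ↦ f.coeff i) j i * ω (AdjoinRoot.root f ^ (j : ℕ) • m) = _
  simp only [companion_apply]
  by_cases hi : (i : ℕ) + 1 = n
  · simp only [if_pos hi]
    rw [hi, root_pow_natDegree_eq_sum hdeg, Finset.sum_smul, map_sum]
    refine Finset.sum_congr rfl fun j _ ↦ ?_
    rw [mul_smul, Int.cast_smul_eq_zsmul, map_zsmul, smul_eq_mul]
  · simp only [if_neg hi]
    have hi' : (i : ℕ) + 1 < n := lt_of_le_of_ne (Nat.succ_le_of_lt i.2) hi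
    rw [Finset.sum_eq_single (⟨(i : ℕ) + 1, hi'⟩ : Fin n)]
    · rw [if_pos rfl, one_mul]
    · intro j _ hj
      rw [if_neg (fun h ↦ hj (Fin.ext h)), zero_mul]
    · exact fun h ↦ absurd (Finset.mem_univ _) h

/-- **The moment map `s ↦ (λ(θⁱ s))_{i<n}` is a `ℤ`-linear isomorphism `ℤ[θ] ≅ ℤⁿ`** (its matrix on the basis
`θⁿ⁻¹, θⁿ⁻², …, 1` is lower unitriangular: `λ(θⁱ · θⁿ⁻¹⁻ʲ) = [i = j]` for `i ≤ j`). [folklore] -/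
private theorem exists_linearEquiv_moments (hdeg : f.natDegree = n) :
    ∃ E : AdjoinRoot f ≃ₗ[ℤ] (Fin n → ℤ), ∀ s i,
      E s i = (AdjoinRoot.modByMonicHom (Fact.out : f.Monic) (AdjoinRoot.root f ^ (i : ℕ) * s)).coeff (n - 1) := by
  have hf : f.Monic := Fact.out
  let Λ : AdjoinRoot f →ₗ[ℤ] ℤ := (lcoeff ℤ (n - 1)).comp (AdjoinRoot.modByMonicHom hf)
  let L : AdjoinRoot f →ₗ[ℤ] (Fin n → ℤ) :=
    LinearMap.pi fun i : Fin n ↦ Λ.comp (LinearMap.mulLeft ℤ (AdjoinRoot.root f ^ (i : ℕ)))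
  have hL : ∀ s i, L s i = (AdjoinRoot.modByMonicHom hf (AdjoinRoot.root f ^ (i : ℕ) * s)).coeff (n - 1) :=
    fun s i ↦ rfl
  let b : Module.Basis (Fin n) ℤ (AdjoinRoot f) :=
    ((AdjoinRoot.powerBasis' hf).basis.reindex (finCongr hdeg)).reindex Fin.revPerm
  have hb : ∀ j : Fin n, b j = AdjoinRoot.root f ^ (n - 1 - (j : ℕ)) := fun j ↦ by
    simp only [b, Module.Basis.reindex_apply, Fin.revPerm_symm, Fin.revPerm_apply, PowerBasis.coe_basis,
      AdjoinRoot.powerBasis'_gen, finCongr_symm, finCongr_apply, Fin.val_cast, Fin.val_rev]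
    congr 1
    omega
  have hentry : ∀ i j : Fin n, (i : ℕ) ≤ j →
      LinearMap.toMatrix b (Pi.basisFun ℤ (Fin n)) L i j = if i = j then 1 else 0 := by
    intro i j hij
    rw [LinearMap.toMatrix_apply, Pi.basisFun_repr, hL, hb, ← pow_add,
      coeff_modByMonicHom_root_pow hdeg (by omega)]
    by_cases h : i = j
    · subst h
      rw [if_pos (by omega), if_pos rfl]
    · rw [if_neg (fun h' ↦ h (Fin.ext (by omega))), if_neg h]
  have hdet : (LinearMap.toMatrix b (Pi.basisFun ℤ (Fin n)) L).det = 1 := by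
    rw [Matrix.det_of_lowerTriangular _ (fun i j hij ↦ ?_)]
    · exact Finset.prod_eq_one fun i _ ↦ by rw [hentry i i le_rfl, if_pos rfl]
    · have hij' : i < j := hij
      rw [hentry i j (le_of_lt hij'), if_neg (ne_of_lt hij')]
  have hunit : IsUnit (LinearMap.toMatrix b (Pi.basisFun ℤ (Fin n)) L).det := by
    rw [hdet]
    exact isUnit_one
  exact ⟨LinearEquiv.ofIsUnitDet hunit, fun s i ↦ by rw [LinearEquiv.ofIsUnitDet_apply, hL]⟩

/-- `E(θ s) = C_fᵀ · E(s)` for the moment isomorphism `E`. [folklore] -/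
private theorem moments_root_mul (hdeg : f.natDegree = n) {E : AdjoinRoot f ≃ₗ[ℤ] (Fin n → ℤ)}
    (hE : ∀ s i, E s i = (AdjoinRoot.modByMonicHom (Fact.out : f.Monic) (AdjoinRoot.root f ^ (i : ℕ) * s)).coeff (n - 1))
    (s : AdjoinRoot f) :
    E (AdjoinRoot.root f * s) = (companion fun i : Fin n ↦ f.coeff i)ᵀ *ᵥ E s := by
  have hf : f.Monic := Fact.out
  let Λ : AdjoinRoot f →ₗ[ℤ] ℤ := (lcoeff ℤ (n - 1)).comp (AdjoinRoot.modByMonicHom hf)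
  have h := transpose_companion_mulVec_eq hdeg (M := AdjoinRoot f) Λ.toAddMonoidHom s
  have h1 : (fun i : Fin n ↦ Λ.toAddMonoidHom (AdjoinRoot.root f ^ (i : ℕ) • s)) = E s :=
    funext fun i ↦ by rw [hE]; rfl
  have h2 : (fun i : Fin n ↦ Λ.toAddMonoidHom (AdjoinRoot.root f ^ (i : ℕ) • AdjoinRoot.root f • s)) =
      E (AdjoinRoot.root f * s) :=
    funext fun i ↦ by rw [hE]; rfl
  rw [h1, h2] at h
  exact h.symm

/-- **FROBENIUS RECIPROCITY for `ℤ[θ] = ℤ[X]/(f)` over `ℤ`**: with `λ : ℤ[θ] → ℤ` the coefficient of `θⁿ⁻¹`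
(`f` monic of degree `n`), every `ℤ`-linear functional `ψ` on a `ℤ[θ]`-module `M` is `λ ∘ φ` for a UNIQUE
`ℤ[θ]`-linear `φ : M → ℤ[θ]` — i.e. `Hom_ℤ(M, ℤ) = λ ∘ Hom_{ℤ[θ]}(M, ℤ[θ])`, the `ℤ`-dual `Hom_ℤ(ℤ[θ], ℤ)` is free
of rank one over `ℤ[θ]` on `λ` (BUCHMANN–LENSTRA: the equation order `A = ℤ[X]/(f)` has `A† ≅ Hom(A, ℤ)`
invertible, `A† = f′(α)⁻¹A`, «so 2.7 implies that `A` is a Gorenstein ring»). Proof: `φ(m)` is the element with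
moments `λ(θⁱ φ(m)) = ψ(θⁱ m)` (the moment map `ℤ[θ] ≅ ℤⁿ` is bijective — unitriangular on `θⁿ⁻¹, …, θ, 1`), and
`θ`-linearity is the common recursion `θⁿ = -Σ fᵢ θⁱ` of both sides. [cite: BuchmannLenstra1994, §2 Example 2.8
with Prop. 2.7 and (2.2), pp. 229–231] [cite: Taussky1974, §4 (II) («the transposed matrix representation»),
p. 68] -/
theorem exists_unique_linearMap_coeff_eq (hdeg : f.natDegree = n) {M : Type*} [AddCommGroup M]
    [Module (AdjoinRoot f) M] (ψ : M →ₗ[ℤ] ℤ) :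
    ∃! φ : M →ₗ[AdjoinRoot f] AdjoinRoot f,
      ∀ m, (AdjoinRoot.modByMonicHom (Fact.out : f.Monic) (φ m)).coeff (n - 1) = ψ m := by
  have hf : f.Monic := Fact.out
  rcases Nat.eq_zero_or_pos n with hn | hn
  · -- degenerate case `n = 0`: `f = 1`, `ℤ[θ] = 0`, `M = 0`
    subst hn
    have h1 : f = 1 := Polynomial.eq_one_of_monic_natDegree_zero hf hdeg
    have hS : Subsingleton (AdjoinRoot f) := by
      refine subsingleton_of_zero_eq_one ?_
      have h2 : (AdjoinRoot.mk f) (1 : ℤ[X]) = 0 := by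
        rw [← h1]
        exact AdjoinRoot.mk_self
      rw [map_one] at h2
      exact h2.symm
    have hM : Subsingleton M := Module.subsingleton (AdjoinRoot f) M
    refine ⟨0, fun m ↦ ?_, fun φ _ ↦ LinearMap.ext fun m ↦ Subsingleton.elim _ _⟩
    simp only [Subsingleton.elim m 0, map_zero, coeff_zero]
  obtain ⟨E, hE⟩ := exists_linearEquiv_moments hdeg
  have hE0 : ∀ s, E s ⟨0, hn⟩ = (AdjoinRoot.modByMonicHom hf s).coeff (n - 1) := fun s ↦ by
    rw [hE]
    change (AdjoinRoot.modByMonicHom hf (AdjoinRoot.root f ^ 0 * s)).coeff (n - 1) = _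
    rw [pow_zero, one_mul]
  -- any solution has prescribed moments
  have hsol : ∀ φ : M →ₗ[AdjoinRoot f] AdjoinRoot f,
      (∀ m, (AdjoinRoot.modByMonicHom hf (φ m)).coeff (n - 1) = ψ m) →
        ∀ m i, E (φ m) i = ψ (AdjoinRoot.root f ^ (i : ℕ) • m) := fun φ hφ m i ↦ by
    rw [hE, ← smul_eq_mul, ← map_smul, hφ]
  -- the candidate: `φ₁ m = E⁻¹ (ψ(θⁱ m))ᵢ`
  let g₀ : M →ₗ[ℤ] (Fin n → ℤ) := LinearMap.pi fun i : Fin n ↦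
    ψ.comp ((LinearMap.lsmul (AdjoinRoot f) M (AdjoinRoot.root f ^ (i : ℕ))).restrictScalars ℤ)
  have hg₀ : ∀ m i, g₀ m i = ψ (AdjoinRoot.root f ^ (i : ℕ) • m) := fun m i ↦ rfl
  let φ₁ : M →ₗ[ℤ] AdjoinRoot f := E.symm.toLinearMap.comp g₀
  have hφ₁ : ∀ m, E (φ₁ m) = g₀ m := fun m ↦ E.apply_symm_apply _
  have hθ : ∀ m, φ₁ (AdjoinRoot.root f • m) = AdjoinRoot.root f * φ₁ m := fun m ↦ by
    apply E.injective
    rw [moments_root_mul hdeg hE, hφ₁, hφ₁]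
    have h := transpose_companion_mulVec_eq hdeg (M := M) ψ.toAddMonoidHom m
    have h1 : (fun i : Fin n ↦ ψ.toAddMonoidHom (AdjoinRoot.root f ^ (i : ℕ) • m)) = g₀ m :=
      funext fun i ↦ (hg₀ m i).symm
    have h2 : (fun i : Fin n ↦ ψ.toAddMonoidHom (AdjoinRoot.root f ^ (i : ℕ) • AdjoinRoot.root f • m)) =
        g₀ (AdjoinRoot.root f • m) :=
      funext fun i ↦ (hg₀ _ i).symm
    rw [h1, h2] at h
    exact h.symm
  have hsmul : ∀ (p : ℤ[X]) (m : M), φ₁ (AdjoinRoot.mk f p • m) = AdjoinRoot.mk f p * φ₁ m := by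
    intro p
    induction p using Polynomial.induction_on with
    | C a =>
      intro m
      rw [AdjoinRoot.mk_C, eq_intCast, Int.cast_smul_eq_zsmul, map_zsmul, zsmul_eq_mul]
    | add p q hp hq =>
      intro m
      rw [map_add, add_smul, map_add, hp, hq, add_mul]
    | monomial k a ih =>
      intro m
      rw [pow_succ, ← mul_assoc, map_mul, AdjoinRoot.mk_X, mul_smul, ih, hθ, mul_assoc]
  let φ : M →ₗ[AdjoinRoot f] AdjoinRoot f :=
    { toFun := φ₁
      map_add' := φ₁.map_add
      map_smul' := fun s m ↦ by
        obtain ⟨p, rfl⟩ := AdjoinRoot.mk_surjective s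
        rw [RingHom.id_apply, smul_eq_mul]
        exact hsmul p m }
  have hφ : ∀ m, φ m = φ₁ m := fun m ↦ rfl
  refine ⟨φ, fun m ↦ ?_, fun φ' hφ' ↦ ?_⟩
  · rw [← hE0, hφ, hφ₁, hg₀]
    change ψ (AdjoinRoot.root f ^ 0 • m) = ψ m
    rw [pow_zero, one_smul]
  · refine LinearMap.ext fun m ↦ E.injective (funext fun i ↦ ?_)
    rw [hsol φ' hφ' m i, hφ, hφ₁, hg₀]

/-- **The Frobenius form is a PERFECT pairing `(s, t) ↦ λ(st)` on `ℤ[θ]`**: every `ℤ`-linear functional on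
`ℤ[θ] = ℤ[X]/(f)` is `t ↦ λ(ts)` for a unique `s` (`Hom_ℤ(ℤ[θ], ℤ) = ℤ[θ]·λ ≅ ℤ[θ]`: reciprocity with `M = ℤ[θ]`,
`φ = ` multiplication by `φ(1)`). [cite: BuchmannLenstra1994, §2 Example 2.8 («`A† = f′(α)⁻¹A` … This shows that
`A†` is invertible»), p. 231] -/
theorem exists_unique_forall_coeff_mul_eq (hdeg : f.natDegree = n) (ψ : AdjoinRoot f →ₗ[ℤ] ℤ) :
    ∃! s : AdjoinRoot f,
      ∀ t, (AdjoinRoot.modByMonicHom (Fact.out : f.Monic) (t * s)).coeff (n - 1) = ψ t := by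
  obtain ⟨φ, hφ, huniq⟩ := exists_unique_linearMap_coeff_eq hdeg (M := AdjoinRoot f) ψ
  refine ⟨φ 1, fun t ↦ ?_, fun s hs ↦ ?_⟩
  · rw [← hφ t, ← smul_eq_mul t (φ 1), ← map_smul, smul_eq_mul, mul_one]
  · have h := huniq (LinearMap.mulRight (AdjoinRoot f) s) fun t ↦ by rw [LinearMap.mulRight_apply, hs]
    have h1 := LinearMap.congr_fun h 1
    rwa [LinearMap.mulRight_apply, one_mul] at h1

/-- **Non-degeneracy of the Frobenius form**: if `λ(ts) = 0` for all `t ∈ ℤ[θ]` then `s = 0`.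
[cite: BuchmannLenstra1994, §2 Example 2.8 with (2.2), pp. 229–231] -/
theorem eq_zero_of_forall_coeff_mul_eq_zero (hdeg : f.natDegree = n) {s : AdjoinRoot f}
    (hs : ∀ t, (AdjoinRoot.modByMonicHom (Fact.out : f.Monic) (t * s)).coeff (n - 1) = 0) : s = 0 := by
  obtain ⟨s₀, -, huniq⟩ := exists_unique_forall_coeff_mul_eq hdeg (0 : AdjoinRoot f →ₗ[ℤ] ℤ)
  rw [huniq s (fun t ↦ by rw [hs, LinearMap.zero_apply]),
    huniq 0 (fun t ↦ by rw [mul_zero, map_zero, coeff_zero, LinearMap.zero_apply])]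

end Frobenius

/-! ### §2 `ℤⁿ_{C_fᵀ} ≅ ℤ[θ]`: the transposed companion matrix also lies in the principal class -/

section Transpose

variable {f : ℤ[X]}

/-- `p(Aᵀ) = p(A)ᵀ`. [folklore] -/
private theorem aeval_transpose_intMatrix (A : _root_.Matrix (Fin n) (Fin n) ℤ) (p : ℤ[X]) :
    aeval Aᵀ p = (aeval A p)ᵀ := by
  induction p using Polynomial.induction_on' with
  | add p q hp hq => rw [map_add, map_add, hp, hq, Matrix.transpose_add]
  | monomial k a =>
    rw [aeval_monomial, aeval_monomial, Algebra.algebraMap_eq_smul_one, smul_mul_assoc, one_mul,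
      smul_mul_assoc, one_mul, Matrix.transpose_smul, Matrix.transpose_pow]

/-- **`f(Aᵀ) = 0 ⟺ f(A) = 0`**: the transpose of a matrix root of `f` is a matrix root of `f`, so «the class of
the transposed matrix» is defined. [cite: Taussky1974, §1, p. 64 («the class of the transposed matrix corresponds
to the complementary ideal class»)] -/
theorem aeval_transpose_eq_zero_iff (A : _root_.Matrix (Fin n) (Fin n) ℤ) : aeval Aᵀ f = 0 ↔ aeval A f = 0 := by
  rw [aeval_transpose_intMatrix, Matrix.transpose_eq_zero]

/-- **Conjugate matrices have conjugate transposes**: `A ∼ B` over `GLₙ(ℤ)` iff `Aᵀ ∼ Bᵀ` (transpose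
`P A = B P`: `(Pᵀ)⁻¹` conjugates `Aᵀ` into `Bᵀ`). [cite: Taussky1974, §1, p. 64] -/
theorem exists_conj_transpose_iff (A B : _root_.Matrix (Fin n) (Fin n) ℤ) :
    (∃ P : _root_.Matrix (Fin n) (Fin n) ℤ, IsUnit P.det ∧ P * Aᵀ = Bᵀ * P) ↔
      ∃ P : _root_.Matrix (Fin n) (Fin n) ℤ, IsUnit P.det ∧ P * A = B * P := by
  have key : ∀ A B : _root_.Matrix (Fin n) (Fin n) ℤ,
      (∃ P : _root_.Matrix (Fin n) (Fin n) ℤ, IsUnit P.det ∧ P * A = B * P) →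
        ∃ P : _root_.Matrix (Fin n) (Fin n) ℤ, IsUnit P.det ∧ P * Aᵀ = Bᵀ * P := by
    rintro A B ⟨P, hP, h⟩
    refine ⟨(Pᵀ)⁻¹, ?_, ?_⟩
    · rw [Matrix.isUnit_nonsing_inv_det_iff]
      exact Matrix.isUnit_det_transpose P hP
    · have hPt : IsUnit Pᵀ.det := Matrix.isUnit_det_transpose P hP
      have h' : Aᵀ * Pᵀ = Pᵀ * Bᵀ := by rw [← Matrix.transpose_mul, ← Matrix.transpose_mul, h]
      calc (Pᵀ)⁻¹ * Aᵀ = (Pᵀ)⁻¹ * Aᵀ * (Pᵀ * (Pᵀ)⁻¹) := by rw [Matrix.mul_nonsing_inv _ hPt, mul_one]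
        _ = (Pᵀ)⁻¹ * (Aᵀ * Pᵀ) * (Pᵀ)⁻¹ := by simp only [mul_assoc]
        _ = Bᵀ * (Pᵀ)⁻¹ := by rw [h', ← mul_assoc, Matrix.nonsing_inv_mul _ hPt, one_mul]
  refine ⟨fun h ↦ ?_, key A B⟩
  simpa only [Matrix.transpose_transpose] using key Aᵀ Bᵀ h

variable [Fact f.Monic]

namespace QuotModule

omit [Fact f.Monic] in
/-- A `ℤ`-linear isomorphism `g : ℤⁿ ≅ N` onto a `ℤ[θ]`-module with `g(A v) = θ · g(v)` is a `ℤ[θ]`-isomorphism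
`ℤⁿ_A ≅ N` (the tree's `lift`). [folklore] -/
private theorem nonempty_linearEquiv_of_linearEquiv {A : _root_.Matrix (Fin n) (Fin n) ℤ} {hA : aeval A f = 0}
    {N : Type*} [AddCommGroup N] [Module (AdjoinRoot f) N] (g : (Fin n → ℤ) ≃ₗ[ℤ] N)
    (hg : ∀ v, g (A *ᵥ v) = AdjoinRoot.root f • g v) : Nonempty (QuotModule f A hA ≃ₗ[AdjoinRoot f] N) := by
  let T : QuotModule f A hA →ₗ[AdjoinRoot f] N := lift g.toLinearMap.toAddMonoidHom hg
  have hT : ∀ v, T (of f A hA v) = g v := fun v ↦ lift_of _ _ v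
  refine ⟨LinearEquiv.ofBijective T ⟨fun x y hxy ↦ ?_, fun s ↦ ?_⟩⟩
  · obtain ⟨v, rfl⟩ := (of f A hA).surjective x
    obtain ⟨w, rfl⟩ := (of f A hA).surjective y
    rw [hT, hT] at hxy
    rw [g.injective hxy]
  · exact ⟨of f A hA (g.symm s), by rw [hT, LinearEquiv.apply_symm_apply]⟩

/-- **`ℤⁿ_{C_fᵀ} ≅ ℤ[θ]`: the TRANSPOSE of the companion matrix also lies in the principal class** — the moment
map `s ↦ (λ(θⁱ s))ᵢ` is a `ℤ`-isomorphism `ℤ[θ] ≅ ℤⁿ` carrying multiplication by `θ` to `C_fᵀ` (§1); this is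
TAUSSKY's «the companion matrix `C` has `1, α, …, αⁿ⁻¹` as an eigenvector» (her companion matrix, acting on rows,
is `C_fᵀ`) — the principal class is its own «complementary» class, `ℤ[θ]` being Gorenstein.
[cite: Taussky1974, §1, p. 64 and §4 (I), p. 68] [cite: BuchmannLenstra1994, §2 Example 2.8, p. 231] -/
theorem nonempty_linearEquiv_companion_transpose (hdeg : f.natDegree = n)
    (hCt : aeval (companion fun i : Fin n ↦ f.coeff i)ᵀ f = 0) :
    Nonempty (QuotModule f (companion fun i : Fin n ↦ f.coeff i)ᵀ hCt ≃ₗ[AdjoinRoot f] AdjoinRoot f) := by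
  obtain ⟨E, hE⟩ := exists_linearEquiv_moments hdeg
  exact nonempty_linearEquiv_of_linearEquiv E.symm fun v ↦ E.injective (by
    rw [E.apply_symm_apply, smul_eq_mul, moments_root_mul hdeg hE, E.apply_symm_apply])

/-- `ℤⁿ_{C_fᵀ} ≅ (1)`, the unit ideal. [cite: Taussky1974, §1, p. 64 and §4 (I), p. 68] -/
theorem nonempty_linearEquiv_companion_transpose_top (hdeg : f.natDegree = n)
    (hCt : aeval (companion fun i : Fin n ↦ f.coeff i)ᵀ f = 0) :
    Nonempty (QuotModule f (companion fun i : Fin n ↦ f.coeff i)ᵀ hCt ≃ₗ[AdjoinRoot f]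
      (⊤ : Ideal (AdjoinRoot f))) :=
  let ⟨e⟩ := nonempty_linearEquiv_companion_transpose hdeg hCt
  ⟨e.trans (Submodule.topEquiv (R := AdjoinRoot f) (M := AdjoinRoot f)).symm⟩

end QuotModule

/-- **The companion matrix is `GLₙ(ℤ)`-conjugate to its transpose** (`f` monic; no irreducibility needed): both
`ℤⁿ_{C_f}` and `ℤⁿ_{C_fᵀ}` are `≅ ℤ[θ]`. [cite: Taussky1974, §1, p. 64 and §4 (I)–(II), p. 68] -/
theorem exists_conj_companion_transpose (hdeg : f.natDegree = n) :
    ∃ P : _root_.Matrix (Fin n) (Fin n) ℤ, IsUnit P.det ∧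
      P * (companion fun i : Fin n ↦ f.coeff i)ᵀ = companion (fun i : Fin n ↦ f.coeff i) * P := by
  have hC := aeval_companion_coeff_eq_zero (Fact.out : f.Monic) hdeg
  have hCt := (aeval_transpose_eq_zero_iff (f := f) (companion fun i : Fin n ↦ f.coeff i)).2 hC
  exact (QuotModule.nonempty_linearEquiv_self_iff_exists_conj_companion (hA := hCt) hdeg hC).1
    (QuotModule.nonempty_linearEquiv_companion_transpose hdeg hCt)

/-- **`Φ [C_fᵀ] = [(1)]`** for every class map `Φ` with `Φ [A] = [J]` whenever `ℤⁿ_A ≅ J` (in particular the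
bijection of `exists_equiv_quot_conj_quot_idealClass`): with `Φ [C_f] = [(1)]` of `LatimerMacDuffeeCompanion`, the
principal class is fixed by transposition. [cite: Taussky1974, §1, p. 64] -/
theorem apply_companion_transpose_eq_top [IsDomain (AdjoinRoot f)] (hdeg : f.natDegree = n)
    (hCt : aeval (companion fun i : Fin n ↦ f.coeff i)ᵀ f = 0) {β : Type*}
    {Φ : Quot (fun A B : {A : _root_.Matrix (Fin n) (Fin n) ℤ // aeval A f = 0} ↦
        ∃ P : _root_.Matrix (Fin n) (Fin n) ℤ, IsUnit P.det ∧ P * A.1 = B.1 * P) → β}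
    {Ψ : {J : Ideal (AdjoinRoot f) // J ≠ ⊥} → β}
    (hΦ : ∀ (A : _root_.Matrix (Fin n) (Fin n) ℤ) (hA : aeval A f = 0) (J : Ideal (AdjoinRoot f)) (hJ : J ≠ ⊥),
      Nonempty (QuotModule f A hA ≃ₗ[AdjoinRoot f] J) → Φ (Quot.mk _ ⟨A, hA⟩) = Ψ ⟨J, hJ⟩) :
    Φ (Quot.mk _ ⟨(companion fun i : Fin n ↦ f.coeff i)ᵀ, hCt⟩) = Ψ ⟨⊤, top_ne_bot⟩ :=
  hΦ _ hCt ⊤ top_ne_bot (QuotModule.nonempty_linearEquiv_companion_transpose_top hdeg hCt)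

end Transpose

/-! ### §3 TRANSPOSE = DUAL: `ℤⁿ_{Aᵀ} ≅ Hom_{ℤ[θ]}(ℤⁿ_A, ℤ[θ])` -/

section Dual

variable {f : ℤ[X]} [Fact f.Monic] {A : _root_.Matrix (Fin n) (Fin n) ℤ}

namespace QuotModule

/-- **TAUSSKY: the module of the transposed matrix is the `ℤ[θ]`-dual module — `ℤⁿ_{Aᵀ} ≅ Hom_{ℤ[θ]}(ℤⁿ_A, ℤ[θ])`**
for every integer matrix `A` with `f(A) = 0` (`f` monic of degree `n`). The `ℤ[θ]`-linear forms `φ` on `ℤⁿ_A`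
correspond to the vectors `w = (λ(φ(eᵢ)))ᵢ ∈ ℤⁿ` (FROBENIUS reciprocity: `φ` is determined by `λ ∘ φ`, an
arbitrary `ℤ`-linear form `v ↦ w·v`), and `θ·φ = φ(θ ·) = φ(A ·)` has the vector `Aᵀ w`. This is the intrinsic
form of «the class of the transposed matrix corresponds to the complementary ideal class» (the complementary = dual
module). [cite: Taussky1974, §1, p. 64; §4 (II) («the transposed matrix representation»), p. 68]
[cite: Taussky1957] -/
theorem nonempty_linearEquiv_transpose_dual (hdeg : f.natDegree = n) (hA : aeval A f = 0)
    (hAt : aeval Aᵀ f = 0) :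
    Nonempty (QuotModule f Aᵀ hAt ≃ₗ[AdjoinRoot f] Module.Dual (AdjoinRoot f) (QuotModule f A hA)) := by
  have hf : f.Monic := Fact.out
  let Λ : AdjoinRoot f →ₗ[ℤ] ℤ := (lcoeff ℤ (n - 1)).comp (AdjoinRoot.modByMonicHom hf)
  have hΛ : ∀ s, Λ s = (AdjoinRoot.modByMonicHom hf s).coeff (n - 1) := fun s ↦ rfl
  -- `Ψ φ = (λ(φ(eᵢ)))ᵢ`, a `ℤ`-linear map `Dual → ℤⁿ`
  let Ψ : Module.Dual (AdjoinRoot f) (QuotModule f A hA) →ₗ[ℤ] (Fin n → ℤ) :=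
    { toFun := fun φ i ↦ Λ (φ (of f A hA (Pi.single i 1)))
      map_add' := fun φ φ' ↦ funext fun i ↦ by
        rw [Pi.add_apply, LinearMap.add_apply, map_add]
      map_smul' := fun z φ ↦ funext fun i ↦ by
        rw [Pi.smul_apply, LinearMap.smul_apply, map_zsmul, RingHom.id_apply] }
  have hΨ : ∀ φ i, Ψ φ i = Λ (φ (of f A hA (Pi.single i 1))) := fun φ i ↦ rfl
  -- the `ℤ`-linear form `v ↦ x · v` on `ℤⁿ_A`
  have hdot : ∀ x : Fin n → ℤ, ∃ ψ : QuotModule f A hA →ₗ[ℤ] ℤ, ∀ v, ψ (of f A hA v) = x ⬝ᵥ v := fun x ↦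
    ⟨{ toFun := fun m ↦ x ⬝ᵥ (of f A hA).symm m
       map_add' := fun m m' ↦ by rw [map_add, dotProduct_add]
       map_smul' := fun z m ↦ by rw [map_zsmul, dotProduct_smul, RingHom.id_apply] },
      fun v ↦ by
        change x ⬝ᵥ (of f A hA).symm (of f A hA v) = x ⬝ᵥ v
        rw [LinearEquiv.symm_apply_apply]⟩
  -- `λ ∘ φ` is determined by its values on the `eᵢ`
  have hext : ∀ φ : Module.Dual (AdjoinRoot f) (QuotModule f A hA), ∀ v,
      Λ (φ (of f A hA v)) = Ψ φ ⬝ᵥ v := fun φ v ↦ by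
    have hv : ∀ i, Pi.single i (v i) = v i • (Pi.single i 1 : Fin n → ℤ) := fun i ↦ by
      rw [← Pi.single_smul', smul_eq_mul, mul_one]
    conv_lhs => rw [← Finset.univ_sum_single v]
    rw [map_sum, map_sum, map_sum, dotProduct]
    refine Finset.sum_congr rfl fun i _ ↦ ?_
    rw [hv, map_zsmul, map_zsmul, map_zsmul, hΨ, smul_eq_mul, mul_comm]
  -- `Ψ` is injective
  have hinj : Function.Injective Ψ := by
    intro φ φ' h
    obtain ⟨ψ, hψ⟩ := hdot (Ψ φ)
    obtain ⟨φ₀, -, huniq⟩ := exists_unique_linearMap_coeff_eq hdeg (M := QuotModule f A hA) ψ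
    have h1 : φ = φ₀ := huniq φ fun m ↦ by
      obtain ⟨v, rfl⟩ := (of f A hA).surjective m
      rw [← hΛ, hext, hψ]
    have h2 : φ' = φ₀ := huniq φ' fun m ↦ by
      obtain ⟨v, rfl⟩ := (of f A hA).surjective m
      rw [← hΛ, hext, ← h, hψ]
    rw [h1, h2]
  -- `Ψ` is surjective
  have hsurj : Function.Surjective Ψ := by
    intro x
    obtain ⟨ψ, hψ⟩ := hdot x
    obtain ⟨φ, hφ, -⟩ := exists_unique_linearMap_coeff_eq hdeg (M := QuotModule f A hA) ψ
    refine ⟨φ, funext fun i ↦ ?_⟩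
    rw [hΨ, hΛ, hφ, hψ, dotProduct_single, mul_one]
  -- `Ψ (θ • φ) = Aᵀ · Ψ φ`
  have hθ : ∀ φ, Ψ (AdjoinRoot.root f • φ) = Aᵀ *ᵥ Ψ φ := fun φ ↦ funext fun i ↦ by
    rw [hΨ, LinearMap.smul_apply, ← map_smul, root_smul_of, Matrix.mulVec_single_one, hext]
    change Ψ φ ⬝ᵥ (fun j ↦ Aᵀ i j) = (fun j ↦ Aᵀ i j) ⬝ᵥ Ψ φ
    exact dotProduct_comm _ _
  let g : (Fin n → ℤ) ≃ₗ[ℤ] Module.Dual (AdjoinRoot f) (QuotModule f A hA) :=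
    (LinearEquiv.ofBijective Ψ ⟨hinj, hsurj⟩).symm
  refine nonempty_linearEquiv_of_linearEquiv g fun v ↦ hinj ?_
  change Ψ ((LinearEquiv.ofBijective Ψ ⟨hinj, hsurj⟩).symm (Aᵀ *ᵥ v)) =
    Ψ (AdjoinRoot.root f • (LinearEquiv.ofBijective Ψ ⟨hinj, hsurj⟩).symm v)
  rw [hθ]
  erw [LinearEquiv.apply_symm_apply (LinearEquiv.ofBijective Ψ ⟨hinj, hsurj⟩),
    LinearEquiv.apply_symm_apply (LinearEquiv.ofBijective Ψ ⟨hinj, hsurj⟩)]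

/-- **Transposition is the duality of the correspondence, module-isomorphism form**: `ℤⁿ_A ≅ ℤⁿ_B` iff
`ℤⁿ_{Aᵀ} ≅ ℤⁿ_{Bᵀ}`, and the dual of `ℤⁿ_{Aᵀ}` is `ℤⁿ_A` back (`Aᵀᵀ = A`): `ℤⁿ_A ≅ Hom_{ℤ[θ]}(ℤⁿ_{Aᵀ}, ℤ[θ])` —
the modules `ℤⁿ_A` are REFLEXIVE. [cite: Taussky1974, §1, p. 64; §4 (II), p. 68] [cite: Taussky1957] -/
theorem nonempty_linearEquiv_dual_transpose (hdeg : f.natDegree = n) (hA : aeval A f = 0)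
    (hAt : aeval Aᵀ f = 0) :
    Nonempty (QuotModule f A hA ≃ₗ[AdjoinRoot f] Module.Dual (AdjoinRoot f) (QuotModule f Aᵀ hAt)) := by
  have hAtt : aeval Aᵀᵀ f = 0 := by rwa [Matrix.transpose_transpose]
  obtain ⟨e⟩ := nonempty_linearEquiv_transpose_dual hdeg hAt hAtt
  have e0 : QuotModule f A hA ≃ₗ[AdjoinRoot f] QuotModule f Aᵀᵀ hAtt :=
    linearEquivOfConj (hA := hA) (hB := hAtt) 1 (by rw [Matrix.det_one]; exact isUnit_one)
      (by rw [one_mul, Matrix.transpose_transpose, mul_one])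
  exact ⟨e0.trans e⟩

end QuotModule

end Dual

/-! ### §4 `Hom_R(J, R) ≅ ((a) : J)` and `((a) : J) = I` when `IJ = (a)` (any domain `R`) -/

section IdealDual

variable {R : Type*} [CommRing R] [IsDomain R]

/-- **`Hom_R(J, R) ≅ ((a) : J)` for an ideal `J` of a domain `R` and `0 ≠ a ∈ J`**, by `φ ↦ φ(a)`: an `R`-linear
`φ : J → R` has `a·φ(j) = j·φ(a)`, so it is «multiplication by `φ(a)/a`» and `φ(a)·J ⊆ (a)`; conversely
`y ∈ ((a) : J)` gives `j ↦ yj/a` (MARSEGLIA: «`Hom_R(I, J) = (J : I)`», here `Hom_R(J, R) = (R : J) ≅ a(R : J) =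
((a) : J)` computed inside `R`). [cite: Marseglia2019, §3 Cor. 3.3, p. 6; §2 («`(I:J) = {x ∈ K : xJ ⊆ I}`»), p. 4] -/
theorem nonempty_dual_linearEquiv_colon {J : Ideal R} {a : R} (ha : a ∈ J) (ha0 : a ≠ 0) :
    Nonempty (Module.Dual R J ≃ₗ[R] (Ideal.span {a}).colon (J : Set R)) := by
  -- `a φ(j) = j φ(a)`
  have key : ∀ (φ : Module.Dual R J) (j : J), a * φ j = (j : R) * φ ⟨a, ha⟩ := fun φ j ↦ by
    rw [← smul_eq_mul, ← smul_eq_mul, ← map_smul, ← map_smul]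
    congr 1
    apply Subtype.ext
    change a * (j : R) = (j : R) * a
    exact mul_comm _ _
  let Θ : Module.Dual R J →ₗ[R] (Ideal.span {a}).colon (J : Set R) :=
    { toFun := fun φ ↦ ⟨φ ⟨a, ha⟩, Submodule.mem_colon.2 fun j hj ↦ by
        rw [smul_eq_mul, mul_comm, ← key φ ⟨j, hj⟩]
        exact Ideal.mul_mem_right _ _ (Ideal.mem_span_singleton_self a)⟩
      map_add' := fun φ φ' ↦ Subtype.ext (LinearMap.add_apply _ _ _)
      map_smul' := fun r φ ↦ Subtype.ext (LinearMap.smul_apply _ _ _) }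
  have hΘ : ∀ φ, (Θ φ : R) = φ ⟨a, ha⟩ := fun φ ↦ rfl
  refine ⟨LinearEquiv.ofBijective Θ ⟨fun φ φ' h ↦ ?_, fun y ↦ ?_⟩⟩
  · have h' : φ ⟨a, ha⟩ = φ' ⟨a, ha⟩ := by rw [← hΘ, ← hΘ, h]
    refine LinearMap.ext fun j ↦ mul_left_cancel₀ ha0 ?_
    rw [key φ j, key φ' j, h']
  · have hy : ∀ j : J, ∃ b : R, b * a = y * j := fun j ↦
      Ideal.mem_span_singleton'.1 (Submodule.mem_colon.1 y.2 j j.2)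
    choose b hb using hy
    let φ : Module.Dual R J :=
      { toFun := b
        map_add' := fun j j' ↦ mul_right_cancel₀ ha0 (by
          rw [add_mul, hb, hb, hb, Submodule.coe_add, mul_add])
        map_smul' := fun r j ↦ mul_right_cancel₀ ha0 (by
          rw [RingHom.id_apply, smul_eq_mul, mul_assoc, hb, hb, Submodule.coe_smul, smul_eq_mul,
            mul_left_comm]) }
    refine ⟨φ, Subtype.ext ?_⟩
    rw [hΘ]
    change b ⟨a, ha⟩ = y
    exact mul_right_cancel₀ ha0 (hb ⟨a, ha⟩)

omit [IsDomain R] in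
/-- `a ∈ ((a) : J)`; in particular `((a) : J) ≠ 0` for `a ≠ 0`. [folklore] -/
private theorem mem_colon_span_singleton_self (J : Ideal R) (a : R) : a ∈ (Ideal.span {a}).colon (J : Set R) :=
  Submodule.mem_colon.2 fun j _ ↦ by
    rw [smul_eq_mul]
    exact Ideal.mul_mem_right _ _ (Ideal.mem_span_singleton_self a)

/-- **«The inverse ideal class»: if `I·J = (a)` with `a ≠ 0` then `((a) : J) = I`** (`⊇`: `IJ ⊆ (a)`; `⊆`: for
`yJ ⊆ (a)`, `ya ∈ yIJ ⊆ I·(a)`, so `ya = za` with `z ∈ I`). [cite: Marseglia2019, §2 («`(I:J)`»), p. 4; §4 proof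
of Prop. 4.1 («`(I:J)` and `(J:I)` are inverse to each other»), p. 8] [cite: Taussky1974, §4 («the transposed matrix
class corresponds to the inverse ideal class»), p. 68] -/
theorem colon_span_singleton_eq_of_mul_eq {I J : Ideal R} {a : R} (ha0 : a ≠ 0) (h : I * J = Ideal.span {a}) :
    (Ideal.span {a}).colon (J : Set R) = I := by
  apply le_antisymm
  · intro y hy
    have hyJ : Ideal.span {y} * J ≤ Ideal.span {a} :=
      Ideal.span_singleton_mul_le_iff.2 fun j hj ↦ by
        simpa only [smul_eq_mul] using Submodule.mem_colon.1 hy j hj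
    have h1 : y * a ∈ I * Ideal.span {a} := by
      have h2 : y * a ∈ Ideal.span {y} * (I * J) := by
        rw [h]
        exact Ideal.mul_mem_mul (Ideal.mem_span_singleton_self y) (Ideal.mem_span_singleton_self a)
      rw [mul_left_comm] at h2
      exact Ideal.mul_mono_right hyJ h2
    obtain ⟨z, hz, hza⟩ := Ideal.mem_mul_span_singleton.1 h1
    rwa [← mul_right_cancel₀ ha0 hza]
  · intro i hi
    refine Submodule.mem_colon.2 fun j hj ↦ ?_
    rw [← h, smul_eq_mul]
    exact Ideal.mul_mem_mul hi hj

end IdealDual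

/-! ### §5 TAUSSKY 1957: the class of `Aᵀ` is the class of `((a) : J)` — the «complementary» / «inverse» class -/

section Taussky

variable {f : ℤ[X]} [Fact f.Monic] [IsDomain (AdjoinRoot f)] {A : _root_.Matrix (Fin n) (Fin n) ℤ}
  {hA : aeval A f = 0} {hAt : aeval Aᵀ f = 0}

namespace QuotModule

/-- **TAUSSKY (1957; 1974, p. 64): «the class of the transposed matrix corresponds to the complementary ideal
class»** — if `ℤⁿ_A ≅ J` for an ideal `J` of `ℤ[θ]` and `0 ≠ a ∈ J`, then `ℤⁿ_{Aᵀ} ≅ ((a) : J) = a·(ℤ[θ] : J)`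
(§3: `ℤⁿ_{Aᵀ} ≅ Hom(ℤⁿ_A, ℤ[θ]) ≅ Hom(J, ℤ[θ])`, and §4). Here the complementary class is realised INSIDE `ℤ[θ]`
by the quotient ideal `((a) : J)`; it is the class of TAUSSKY's complementary ideal `J′ = {x : Tr(xJ) ⊆ ℤ} =
f′(θ)⁻¹(ℤ[θ] : J)` because `ℤ[θ]ᵗ = f′(θ)⁻¹ℤ[θ]` (EULER; the tree's `traceDual_adjoin_eq`).
[cite: Taussky1974, §1, p. 64; §4 (II), p. 68] [cite: Taussky1957] [cite: Marseglia2019, §3 Cor. 3.3, p. 6] -/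
theorem nonempty_linearEquiv_transpose_colon (hdeg : f.natDegree = n) {J : Ideal (AdjoinRoot f)}
    (e : QuotModule f A hA ≃ₗ[AdjoinRoot f] J) {a : AdjoinRoot f} (ha : a ∈ J) (ha0 : a ≠ 0) :
    Nonempty (QuotModule f Aᵀ hAt ≃ₗ[AdjoinRoot f] (Ideal.span {a}).colon (J : Set (AdjoinRoot f))) := by
  obtain ⟨e₁⟩ := nonempty_linearEquiv_transpose_dual hdeg hA hAt
  obtain ⟨e₃⟩ := nonempty_dual_linearEquiv_colon ha ha0
  exact ⟨(e₁.trans e.symm.dualMap).trans e₃⟩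

/-- **TAUSSKY: «the transposed matrix class corresponds to the INVERSE ideal class»** — if `ℤⁿ_A ≅ J` and
`I·J = (a)` with `a ≠ 0` (so `[I] = [J]⁻¹` in the ideal class monoid), then `ℤⁿ_{Aᵀ} ≅ I` (§5 with
`((a) : J) = I`, §4). For the maximal order every class has such an inverse; in general this is the case of an
invertible `J`. [cite: Taussky1974, §4 («we want to exploit the fact that the transposed matrix class corresponds
to the inverse ideal class»), p. 68; §1, p. 64] [cite: Taussky1957] -/
theorem nonempty_linearEquiv_transpose_of_mul_eq (hdeg : f.natDegree = n) {I J : Ideal (AdjoinRoot f)}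
    (e : QuotModule f A hA ≃ₗ[AdjoinRoot f] J) {a : AdjoinRoot f} (ha0 : a ≠ 0) (hIJ : I * J = Ideal.span {a}) :
    Nonempty (QuotModule f Aᵀ hAt ≃ₗ[AdjoinRoot f] I) := by
  have ha : a ∈ J := Ideal.mul_le_left (I := I) (J := J) (by
    rw [hIJ]
    exact Ideal.mem_span_singleton_self a)
  obtain ⟨e'⟩ := nonempty_linearEquiv_transpose_colon (hAt := hAt) hdeg e ha ha0
  exact ⟨e'.trans (LinearEquiv.ofEq _ _ (colon_span_singleton_eq_of_mul_eq ha0 hIJ))⟩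

end QuotModule

/-- **`Φ [Aᵀ] = [((a) : J)]` when `Φ [A] = [J]`**: every class map `Φ` with `Φ [A] = [J]` whenever `ℤⁿ_A ≅ J` (in
particular the bijection of `exists_equiv_quot_conj_quot_idealClass`) sends the class of the transpose to the
class of the quotient ideal — TAUSSKY's complementary class; with §2 (`Φ [C_fᵀ] = [(1)]`) and
`LatimerMacDuffeeCompanion` (`Φ [C_f] = [(1)]`). [cite: Taussky1974, §1, p. 64] [cite: Taussky1957] -/
theorem apply_transpose_eq_colon (hdeg : f.natDegree = n) {β : Type*}
    {Φ : Quot (fun A B : {A : _root_.Matrix (Fin n) (Fin n) ℤ // aeval A f = 0} ↦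
        ∃ P : _root_.Matrix (Fin n) (Fin n) ℤ, IsUnit P.det ∧ P * A.1 = B.1 * P) → β}
    {Ψ : {J : Ideal (AdjoinRoot f) // J ≠ ⊥} → β}
    (hΦ : ∀ (A : _root_.Matrix (Fin n) (Fin n) ℤ) (hA : aeval A f = 0) (J : Ideal (AdjoinRoot f)) (hJ : J ≠ ⊥),
      Nonempty (QuotModule f A hA ≃ₗ[AdjoinRoot f] J) → Φ (Quot.mk _ ⟨A, hA⟩) = Ψ ⟨J, hJ⟩)
    {J : Ideal (AdjoinRoot f)} (e : QuotModule f A hA ≃ₗ[AdjoinRoot f] J) {a : AdjoinRoot f} (ha : a ∈ J)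
    (ha0 : a ≠ 0) :
    Φ (Quot.mk _ ⟨Aᵀ, hAt⟩) = Ψ ⟨(Ideal.span {a}).colon (J : Set (AdjoinRoot f)), fun h ↦ ha0
      ((Submodule.mem_bot (R := AdjoinRoot f)).1 (h ▸ mem_colon_span_singleton_self J a))⟩ :=
  hΦ _ hAt _ _ (QuotModule.nonempty_linearEquiv_transpose_colon hdeg e ha ha0)

/-- **`Φ [Aᵀ] = [I]` when `Φ [A] = [J]` and `IJ = (a)`** (the inverse class). [cite: Taussky1974, §4, p. 68]
[cite: Taussky1957] -/
theorem apply_transpose_eq_of_mul_eq (hdeg : f.natDegree = n) {β : Type*}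
    {Φ : Quot (fun A B : {A : _root_.Matrix (Fin n) (Fin n) ℤ // aeval A f = 0} ↦
        ∃ P : _root_.Matrix (Fin n) (Fin n) ℤ, IsUnit P.det ∧ P * A.1 = B.1 * P) → β}
    {Ψ : {J : Ideal (AdjoinRoot f) // J ≠ ⊥} → β}
    (hΦ : ∀ (A : _root_.Matrix (Fin n) (Fin n) ℤ) (hA : aeval A f = 0) (J : Ideal (AdjoinRoot f)) (hJ : J ≠ ⊥),
      Nonempty (QuotModule f A hA ≃ₗ[AdjoinRoot f] J) → Φ (Quot.mk _ ⟨A, hA⟩) = Ψ ⟨J, hJ⟩)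
    {I J : Ideal (AdjoinRoot f)} (e : QuotModule f A hA ≃ₗ[AdjoinRoot f] J) {a : AdjoinRoot f} (ha0 : a ≠ 0)
    (hIJ : I * J = Ideal.span {a}) (hI : I ≠ ⊥) :
    Φ (Quot.mk _ ⟨Aᵀ, hAt⟩) = Ψ ⟨I, hI⟩ :=
  hΦ _ hAt _ _ (QuotModule.nonempty_linearEquiv_transpose_of_mul_eq hdeg e ha0 hIJ)

/-! ### §6 When is `A ∼ Aᵀ`? -/

/-- **`A ∼ Aᵀ` over `GLₙ(ℤ)` iff the ideal `J` of `A` lies in the same class as `((a) : J)`** (`0 ≠ a ∈ J`), i.e. iff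
the class of `J` is «self-complementary» (TAUSSKY's Theorems 2–3 applied to §5). [cite: Taussky1974, §1, p. 64;
§4 (II), p. 68] [cite: Taussky1957] [cite: Taussky1949, Theorems 2–3] -/
theorem exists_conj_transpose_self_iff_idealClass (hdeg : f.natDegree = n) {J : Ideal (AdjoinRoot f)}
    (e : QuotModule f A hA ≃ₗ[AdjoinRoot f] J) {a : AdjoinRoot f} (ha : a ∈ J) (ha0 : a ≠ 0) :
    (∃ P : _root_.Matrix (Fin n) (Fin n) ℤ, IsUnit P.det ∧ P * A = Aᵀ * P) ↔
      ∃ x y : AdjoinRoot f, x ≠ 0 ∧ y ≠ 0 ∧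
        Ideal.span {x} * J = Ideal.span {y} * (Ideal.span {a}).colon (J : Set (AdjoinRoot f)) := by
  have hAt : aeval Aᵀ f = 0 := (aeval_transpose_eq_zero_iff A).2 hA
  have hJ : J ≠ ⊥ := fun h ↦ ha0 ((Submodule.mem_bot (R := AdjoinRoot f)).1 (h ▸ ha))
  obtain ⟨e'⟩ := QuotModule.nonempty_linearEquiv_transpose_colon (hAt := hAt) hdeg e ha ha0
  exact ⟨fun ⟨P, hP, h⟩ ↦ exists_span_singleton_mul_eq_of_mul_eq_mul hJ e e' hP h,
    fun ⟨x, y, hx, hy, h⟩ ↦ exists_isUnit_det_and_mul_eq_mul_of_linearEquiv e e' hx hy h⟩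

omit [IsDomain (AdjoinRoot f)] in
/-- **A matrix root of `f` in the principal class is conjugate to its transpose**: if `ℤⁿ_A ≅ ℤ[θ]` then `A ∼ Aᵀ`
(`A ∼ C_f`, hence `Aᵀ ∼ C_fᵀ ∼ C_f ∼ A` by §2). [cite: Taussky1974, §1, p. 64; §4 (I)–(II), p. 68] -/
theorem exists_conj_transpose_self_of_nonempty_linearEquiv (hdeg : f.natDegree = n) (hA : aeval A f = 0)
    (h : Nonempty (QuotModule f A hA ≃ₗ[AdjoinRoot f] AdjoinRoot f)) :
    ∃ P : _root_.Matrix (Fin n) (Fin n) ℤ, IsUnit P.det ∧ P * A = Aᵀ * P := by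
  have hf : f.Monic := Fact.out
  have hAt : aeval Aᵀ f = 0 := (aeval_transpose_eq_zero_iff A).2 hA
  have hC := aeval_companion_coeff_eq_zero hf hdeg
  have hCt := (aeval_transpose_eq_zero_iff (f := f) (companion fun i : Fin n ↦ f.coeff i)).2 hC
  obtain ⟨P, hP, hPA⟩ := (QuotModule.nonempty_linearEquiv_self_iff_exists_conj_companion (hA := hA) hdeg hC).1 h
  obtain ⟨Q, hQ, hQA⟩ := (exists_conj_transpose_iff A (companion fun i : Fin n ↦ f.coeff i)).2 ⟨P, hP, hPA⟩
  obtain ⟨eCt⟩ := QuotModule.nonempty_linearEquiv_companion_transpose hdeg hCt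
  obtain ⟨eA⟩ := h
  exact QuotModule.exists_isUnit_det_of_linearEquiv
    ((eA.trans eCt.symm).trans (QuotModule.linearEquivOfConj (hA := hAt) (hB := hCt) Q hQ hQA).symm)

/-- **In the class-number-one case every matrix root of `f` is `GLₙ(ℤ)`-conjugate to its transpose** (every
`ℤⁿ_A ≅ ℤ[θ]`). [cite: Taussky1974, §1, p. 64] [cite: Taussky1949, Theorems 1–4] -/
theorem exists_conj_transpose_self_of_isPrincipalIdealRing [IsPrincipalIdealRing (AdjoinRoot f)]
    (hdeg : f.natDegree = n) (hA : aeval A f = 0) :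
    ∃ P : _root_.Matrix (Fin n) (Fin n) ℤ, IsUnit P.det ∧ P * A = Aᵀ * P := by
  have hC := aeval_companion_coeff_eq_zero (Fact.out : f.Monic) hdeg
  exact exists_conj_transpose_self_of_nonempty_linearEquiv hdeg hA
    ((QuotModule.nonempty_linearEquiv_self_iff_exists_conj_companion (hA := hA) hdeg hC).2
      (exists_conj_companion_of_isPrincipalIdealRing hdeg hA))

end Taussky

end Literature.LinearAlgebra.Matrix
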